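import Summits.HodgeConjecture.HodgeConjecture.Theorems.LimitExtensionHodgeFourfoldsOfFacts
import Literature.AlgebraicGeometry.HodgeTheory.HodgeRiemannPolarizabilityProofs

/-!
# Route LimitExtension · `HodgeFourfolds` (stmt-HodgeConjecture-10866) — the Gysin lift discharged

Companion of `Theorems/LimitExtensionHodgeFourfoldsOfFacts` (`hodgeFourfolds_of_facts`: the route
decl `HodgeFourfolds` from four inputs — Lefschetz `(1,1)`, Deligne's Hodge III Cor. 8.2.8, the
lifting of Hodge classes along Gysin surjections `Voisin2025_hodgeClass_lift_complexGysin`, and the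
route's support item `SpecialisationOfAlgebraicity`, stmt-HodgeConjecture-2998) and of
`Theorems/LimitExtensionHodgeFourfoldsOfSpread` (the same with stmt-2998 replaced by SPREAD).
The third input is now a THEOREM of the tree:
`Literature.AlgebraicGeometry.HodgeTheory.Voisin2025_hodgeClass_lift_complexGysin_holds`
(`HodgeTheory/HodgeRiemannPolarizabilityProofs`, 2026-08-16: the Hodge structures of smooth
projective varieties are polarised by the hyperplane class — hard Lefschetz, Lefschetz
decomposition over `ℚ`, Hodge–Riemann bilinear relations, Voisin I §7.1.2 — whence Voisin (2025)
Cor. 2.12 by semisimplicity; relies on nothing unproved). Feeding it leaves the item CLOSED MODULO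
exactly

* `lefschetzOneOne_rational` (leaf: Serre's GAGA n° 20 Prop. 18 for line bundles,
  `serreGAGA_lineCocycle_iso_cartierDivisorCocycle`) — codimensions `1`, `3`, and `(1,1)` on the
  resolved divisor inside codimension `2`;
* `Deligne1974_ker_restrictCompl_eq_iSup_range_complexGysin` (leaf: Hodge III Prop. 8.2.7,
  `Deligne1974_ker_pullback_eq_ker_pullback_resolution`; mixed Hodge theory) — the divisor descent
  in codimension `2`;
* stmt-2998 `SpecialisationOfAlgebraicity` (its residual SPREAD is isolated in
  `Theorems/LimitExtensionSpecialisationOfAlgebraicityOfSpread`, cf.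
  `hodgeFourfolds_of_facts_of_spread`) — the specialised term `(g ≫ ι)^* B` in codimension `2`:

`hodgeFourfolds_of_two_facts` (two named facts + stmt-2998) and `hodgeFourfolds_of_two_leaves`
(their two leaves + stmt-2998).
-/

noncomputable section

-- every declaration of this problem lives in `Summit.HodgeConjecture.HodgeConjecture.…` (summit = sub-problem)
set_option linter.dupNamespace false

open CategoryTheory AlgebraicGeometry
open Literature.AlgebraicGeometry Literature.AlgebraicGeometry.Motives
open Literature.AlgebraicGeometry.HodgeTheory

namespace Summit.HodgeConjecture.HodgeConjecture.Theorems

/-- **`HodgeFourfolds` (stmt-HodgeConjecture-10866) from TWO named facts and the specialisation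
lemma.** Granted Lefschetz `(1,1)` (`hL`, Voisin I Thm. 11.30) and Deligne's Hodge III Cor. 8.2.8
(`hD`), together with the route's Hodge-free specialisation lemma `hS` (stmt-HodgeConjecture-2998),
Hodge models + `LimitExtensionFour` + `HypersurfaceHodgeFour` give the Hodge conjecture for every
smooth projective complex fourfold: `hodgeFourfolds_of_facts` with its Gysin-lift hypothesis fed the
tree's theorem `Voisin2025_hodgeClass_lift_complexGysin_holds` (polarizability of the Hodge
structures of smooth projective varieties, Voisin I §7.1.2, and semisimplicity, Voisin 2025
Cor. 2.12). [cite: VoisinHodgeI2002, Thm. 11.30 and §7.1.2] [cite: DeligneHodgeIII1974, Cor. 8.2.8]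
[cite: Voisin2025, Cor. 2.12] [cite: Murre1977, Remark 1 (p. 230)] [cite: Thomas2005Nodes, Prop. 2] -/
theorem hodgeFourfolds_of_two_facts (hL : lefschetzOneOne_rational)
    (hD : Deligne1974_ker_restrictCompl_eq_iSup_range_complexGysin)
    (hS : Theses.LimitExtension.SpecialisationOfAlgebraicity) :
    Theses.LimitExtension.HodgeFourfolds :=
  hodgeFourfolds_of_facts hL hD Voisin2025_hodgeClass_lift_complexGysin_holds hS

/-- **`HodgeFourfolds` on the two remaining Literature LEAVES plus stmt-2998**: GAGA for line
bundles (`hG`, Serre n° 20 Prop. 18 ⟹ Lefschetz `(1,1)`, `lefschetzOneOne_rational_of_serreGAGA`)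
and Deligne's Hodge III Prop. 8.2.7 (`h827` ⟹ Cor. 8.2.8,
`Deligne1974_ker_restrictCompl_eq_iSup_range_complexGysin_holds_of`), with the route's
specialisation lemma `hS`; hard Lefschetz, Hodge models, de Rham's theorem and the polarizability
are tree theorems. [cite: SerreGAGA1956, n° 20 Prop. 18]
[cite: DeligneHodgeIII1974, Prop. 8.2.7 and Cor. 8.2.8] [cite: VoisinHodgeI2002, Thm. 11.30] -/
theorem hodgeFourfolds_of_two_leaves (hG : serreGAGA_lineCocycle_iso_cartierDivisorCocycle)
    (h827 : Deligne1974_ker_pullback_eq_ker_pullback_resolution)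
    (hS : Theses.LimitExtension.SpecialisationOfAlgebraicity) :
    Theses.LimitExtension.HodgeFourfolds :=
  hodgeFourfolds_of_two_facts (lefschetzOneOne_rational_of_serreGAGA hG)
    (Deligne1974_ker_restrictCompl_eq_iSup_range_complexGysin_holds_of h827) hS

end Summit.HodgeConjecture.HodgeConjecture.Theorems

end
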